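import Summits.HodgeConjecture.HodgeConjecture.Theorems.F0P3InnerFormClassificationV6   -- ★ p822609 V6-D (→ ★ V6-A/B/C): the v6 laws (un-levelled texts), `KitFamily`
import Summits.HodgeConjecture.HodgeConjecture.Theorems.F0P3ClassificationLawsV7    -- ★ p823660 V7-B: the two GUARDED `P`-laws `Routing`∕`LocalIsotypyFin` (v7 = v8 text), v7 `CoefficientFormula`
import Summits.HodgeConjecture.HodgeConjecture.Theorems.F0P3InnerFormClassificationV8   -- V8-D (→ V8-B/C/R over ★ V6-A): the edition of record (THE LEVEL PASS)
import HarnessLib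

/-!
# `F0P3ClassificationBridgeV8` (T5 edition bridge V6∕V7 → V8, THE LEVEL PASS, RULING (V44) ∕ REF1 R-28): law texts that v7∕v8 leave UNCHANGED are the SAME
# proposition (`Iff.rfl`); the eight `S`-indexed letter laws (and the derived `Separation`, `PerClassIdentity`, `CoefficientFormula`) now carry a level guard
# `S₀ ⊆ S`, so their un-levelled v6 texts imply the v8 texts AT EVERY `S₀` (one-way, a fortiori); `Laws`, `KitFamily.Laws` (`∃ S₀` per frame) transport with `S₀ := ∅`

Purpose (F0P3-plan (g5) 13:02:08Z «YES, add the bridges»; (V44) «laws with unchanged text keep `_iff_v6`; guarded ones get one-way adapters»; p04 (g7) K7 ED. 4 ∕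
`KitFamilyOfRecord` ED. 3 re-base): a ★ law instance proved against a V6 (or V7) NAME at the kit of record `kitOfRecord …` (★ K0 — a V8 kit by `rfl`, the V8 kit type
being the reducible alias `…V8.ClassificationKit := …V6.ClassificationKit`) transports to the V8 name by `(‹law›_iff_v6 _).2` ∕ `‹law›_of_v6 _ h S₀`.  NOTE (R-28): an
UN-levelled v6∕v7 instance of a guarded law is in general NOT print-true at the kit of record; these one-way bridges only say that IF one holds, the levelled law holds at
every `S₀` — the closer feeds the levelled laws from levelled letters (`∃ S₀`), not through these.  Theorems only (`Iff.rfl` ∕ `rfl` ∕ λ-re-packing); no `sorry`, no named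
fact, no instance, no notation.  `--supports stmt-HodgeConjecture-24833 --as helper`.
HONEST LABEL: HC_CM is proved only modulo the printed citations until rung 0 closes.
-/

set_option autoImplicit false
set_option linter.dupNamespace false

noncomputable section

open NumberField IsDedekindDomain MeasureTheory
open scoped Matrix ComplexOrder

namespace Summit.HodgeConjecture.HodgeConjecture.Cruxes.H413.F0P3InnerFormClassificationV8

open Literature.NumberTheory.Rogawski1990 Literature.NumberTheory.GaloisRepresentations
open Literature.NumberTheory.Automorphic Literature.NumberTheory.Automorphic.UnitaryGroup

namespace ClassificationKit

variable {L : Type} [Field L] [NumberField L] [IsCMField L] {H : Matrix (Fin 3) (Fin 3) L} {ι : L →+* ℂ} {T : GL (Fin 3) ℂ}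
  {hT : (T : Matrix (Fin 3) (Fin 3) ℂ)ᴴ * H.map ι * (T : Matrix (Fin 3) (Fin 3) ℂ) = Literature.Geometry.ComplexHyperbolic.BallModel.J}
  {μ : Measure (F0P3InnerFormClassificationV6.Gp L H).automorphicQuotient} [(F0P3InnerFormClassificationV6.Gp L H).IsAutomorphicMeasure μ]
  (𝔠 : ClassificationKit L H ι T hT μ)

/-! ## §1 Law texts unchanged by v7 and v8: the same proposition at both editions -/

/-- v8 `TraceIdentity` ≡ v6 `TraceIdentity` (text byte-unchanged by the books pass and the level pass). [cite: Rogawski1990, §14.6 pp. 236–239] -/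
theorem traceIdentity_iff_v6 : 𝔠.TraceIdentity ↔ F0P3InnerFormClassificationV6.ClassificationKit.TraceIdentity 𝔠 := Iff.rfl

/-- v8 `SpectralSideGp` ≡ v6 `SpectralSideGp` (text byte-unchanged by the books pass and the level pass). [cite: Rogawski1990, §14.6 pp. 236–239] -/
theorem spectralSideGp_iff_v6 : 𝔠.SpectralSideGp ↔ F0P3InnerFormClassificationV6.ClassificationKit.SpectralSideGp 𝔠 := Iff.rfl

/-- v8 `HatInjective` ≡ v6 `HatInjective` (text byte-unchanged by the books pass and the level pass). [cite: Rogawski1990, §14.6 pp. 236–239] -/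
theorem hatInjective_iff_v6 : 𝔠.HatInjective ↔ F0P3InnerFormClassificationV6.ClassificationKit.HatInjective 𝔠 := Iff.rfl

/-- v8 `LinIndepS` ≡ v6 `LinIndepS` (text byte-unchanged by the books pass and the level pass). [cite: Rogawski1990, §14.6 pp. 236–239] -/
theorem linIndepS_iff_v6 : 𝔠.LinIndepS ↔ F0P3InnerFormClassificationV6.ClassificationKit.LinIndepS 𝔠 := Iff.rfl

/-- v8 `UnitaryCoord` ≡ v6 `UnitaryCoord` (text byte-unchanged by the books pass and the level pass). [cite: Rogawski1990, §14.6 pp. 236–239] -/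
theorem unitaryCoord_iff_v6 : 𝔠.UnitaryCoord ↔ F0P3InnerFormClassificationV6.ClassificationKit.UnitaryCoord 𝔠 := Iff.rfl

/-- v8 `TokenInf` ≡ v6 `TokenInf` (text byte-unchanged by the books pass and the level pass). [cite: Rogawski1990, §14.6 pp. 236–239] -/
theorem tokenInf_iff_v6 : 𝔠.TokenInf ↔ F0P3InnerFormClassificationV6.ClassificationKit.TokenInf 𝔠 := Iff.rfl

/-- v8 `ArchPacketCoh` ≡ v6 `ArchPacketCoh` (text byte-unchanged by the books pass and the level pass). [cite: Rogawski1990, §14.6 pp. 236–239] -/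
theorem archPacketCoh_iff_v6 : 𝔠.ArchPacketCoh ↔ F0P3InnerFormClassificationV6.ClassificationKit.ArchPacketCoh 𝔠 := Iff.rfl

/-- v8 `UnramMember` ≡ v6 `UnramMember` (text byte-unchanged by the books pass and the level pass). [cite: Rogawski1990, §14.6 pp. 236–239] -/
theorem unramMember_iff_v6 : 𝔠.UnramMember ↔ F0P3InnerFormClassificationV6.ClassificationKit.UnramMember 𝔠 := Iff.rfl

/-- v8 `XiUnram` ≡ v6 `XiUnram` (text byte-unchanged by the books pass and the level pass). [cite: Rogawski1990, §14.6 pp. 236–239] -/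
theorem xiUnram_iff_v6 : 𝔠.XiUnram ↔ F0P3InnerFormClassificationV6.ClassificationKit.XiUnram 𝔠 := Iff.rfl

/-- v8 `EvpConvention` ≡ v6 `EvpConvention` (text byte-unchanged by the books pass and the level pass). [cite: Rogawski1990, §14.6 pp. 236–239] -/
theorem evpConvention_iff_v6 : 𝔠.EvpConvention ↔ F0P3InnerFormClassificationV6.ClassificationKit.EvpConvention 𝔠 := Iff.rfl

/-- v8 `ArchMember` ≡ v6 `ArchMember` (text byte-unchanged). [cite: Rogawski1990, §14.6 pp. 236–239] -/
theorem archMember_iff_v6 (μω : HeckeCharacter L) : 𝔠.ArchMember μω ↔ F0P3InnerFormClassificationV6.ClassificationKit.ArchMember 𝔠 μω := Iff.rfl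

/-- v8 `CptXiSpec` ≡ v6 `CptXiSpec` (text byte-unchanged). [cite: Rogawski1990, §14.6 pp. 236–239] -/
theorem cptXiSpec_iff_v6 (μω : HeckeCharacter L) : 𝔠.CptXiSpec μω ↔ F0P3InnerFormClassificationV6.ClassificationKit.CptXiSpec 𝔠 μω := Iff.rfl

/-- v8 `XiFamilyFin` ≡ v6 `XiFamilyFin` (text byte-unchanged). [cite: Rogawski1990, §14.6 pp. 236–239] -/
theorem xiFamilyFin_iff_v6 (μω : HeckeCharacter L) (hμu : μω.IsUnitary) : 𝔠.XiFamilyFin μω hμu ↔ F0P3InnerFormClassificationV6.ClassificationKit.XiFamilyFin 𝔠 μω hμu := Iff.rfl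

/-! ## §2 The two `P`-laws guarded at v7 (`IsCot P → KcTrivial P →`): v8 text = v7 text; one way from v6 -/

/-- v8 (L3′) `Routing` ≡ v7 `Routing` (guarded text unchanged by the level pass). [cite: Rogawski1990, §15.3 ¶1 p. 244] -/
theorem routing_iff_v7 : 𝔠.Routing ↔ F0P3InnerFormClassificationV7.ClassificationKit.Routing 𝔠 := Iff.rfl

/-- v6 (L3′) `Routing` (unguarded) ⇒ v8 `Routing`, a fortiori. [cite: Rogawski1990, §15.3 ¶1 p. 244] -/
theorem routing_of_v6 (h : F0P3InnerFormClassificationV6.ClassificationKit.Routing 𝔠) : 𝔠.Routing :=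
  fun P _ _ => h P

/-- v8 (L7″) `LocalIsotypyFin` ≡ v7 `LocalIsotypyFin`. [cite: FlathCorvallis1979, Thm. 3] -/
theorem localIsotypyFin_iff_v7 : 𝔠.LocalIsotypyFin ↔ F0P3InnerFormClassificationV7.ClassificationKit.LocalIsotypyFin 𝔠 := Iff.rfl

/-- v6 (L7″) `LocalIsotypyFin` (unguarded) ⇒ v8 `LocalIsotypyFin`, a fortiori. [cite: FlathCorvallis1979, Thm. 3] -/
theorem localIsotypyFin_of_v6 (h : F0P3InnerFormClassificationV6.ClassificationKit.LocalIsotypyFin 𝔠) : 𝔠.LocalIsotypyFin :=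
  fun P _ _ => h P

/-! ## §3 The LEVEL PASS (v8, R-28): un-levelled v6 texts imply the levelled texts at every `S₀` (one way) -/

/-- v6 `Factorisation` (asserted at every `S`) ⇒ v8 `Factorisation S₀` (asserted at `S ⊇ S₀`) for every `S₀`, a fortiori (R-28: the converse is what print denies). [cite: FlathCorvallis1979, Thm. 3] [cite: Rogawski1990, §13.7 p. 206] -/
theorem factorisation_of_v6 (h : F0P3InnerFormClassificationV6.ClassificationKit.Factorisation 𝔠) (S₀ : Finset (F0P3InnerFormClassificationV6.Places L)) : 𝔠.Factorisation S₀ :=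
  ⟨fun S c fS fT _ => h.1 S c fS fT, fun S Q fSG fT _ => h.2.1 S Q fSG fT, fun S ρ fSH fT _ => h.2.2 S ρ fSH fT⟩

/-- v6 `MatchingS` (asserted at every `S`) ⇒ v8 `MatchingS S₀` (asserted at `S ⊇ S₀`) for every `S₀`, a fortiori (R-28: the converse is what print denies). [cite: Rogawski1990, §14.2 (14.2.1) p. 232] -/
theorem matchingS_of_v6 (h : F0P3InnerFormClassificationV6.ClassificationKit.MatchingS 𝔠) (S₀ : Finset (F0P3InnerFormClassificationV6.Places L)) : 𝔠.MatchingS S₀ :=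
  fun S fS fSG fSH fT _ hM => h S fS fSG fSH fT hM

/-- v6 `TransferS` (asserted at every `S`) ⇒ v8 `TransferS S₀` (asserted at `S ⊇ S₀`) for every `S₀`, a fortiori (R-28: the converse is what print denies). [cite: Rogawski1990, §14.2 p. 228; Prop. 4.9.1] -/
theorem transferS_of_v6 (h : F0P3InnerFormClassificationV6.ClassificationKit.TransferS 𝔠) (S₀ : Finset (F0P3InnerFormClassificationV6.Places L)) : 𝔠.TransferS S₀ :=
  fun S _ fS => h S fS

/-- v6 `Separation` (asserted at every `S`) ⇒ v8 `Separation S₀` (asserted at `S ⊇ S₀`) for every `S₀`, a fortiori (R-28: the converse is what print denies). [cite: Langlands1980, pp. 208–211] [cite: Rogawski1990, §13.7 p. 206] -/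
theorem separation_of_v6 (h : F0P3InnerFormClassificationV6.ClassificationKit.Separation 𝔠) (S₀ : Finset (F0P3InnerFormClassificationV6.Places L)) : 𝔠.Separation S₀ :=
  fun S _ => h S

/-- v6 `HatBounded` (asserted at every `S`) ⇒ v8 `HatBounded S₀` (asserted at `S ⊇ S₀`) for every `S₀`, a fortiori (R-28: the converse is what print denies). [cite: Langlands1980, p. 209] -/
theorem hatBounded_of_v6 (h : F0P3InnerFormClassificationV6.ClassificationKit.HatBounded 𝔠) (S₀ : Finset (F0P3InnerFormClassificationV6.Places L)) : 𝔠.HatBounded S₀ :=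
  fun S _ fT => h S fT

/-- v6 `UnrStarAlgebra` (asserted at every `S`) ⇒ v8 `UnrStarAlgebra S₀` (asserted at `S ⊇ S₀`) for every `S₀`, a fortiori (R-28: the converse is what print denies). [cite: CartierCorvallis1979, §IV.1] -/
theorem unrStarAlgebra_of_v6 (h : F0P3InnerFormClassificationV6.ClassificationKit.UnrStarAlgebra 𝔠) (S₀ : Finset (F0P3InnerFormClassificationV6.Places L)) : 𝔠.UnrStarAlgebra S₀ :=
  fun S _ => h S

/-- v6 `UnitaryPacket` (asserted at every `S`) ⇒ v8 `UnitaryPacket S₀` (asserted at `S ⊇ S₀`) for every `S₀`, a fortiori (R-28: the converse is what print denies). [cite: Rogawski1990, §12.2 p. 174; Prop. 13.1.3] -/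
theorem unitaryPacket_of_v6 (h : F0P3InnerFormClassificationV6.ClassificationKit.UnitaryPacket 𝔠) (S₀ : Finset (F0P3InnerFormClassificationV6.Places L)) : 𝔠.UnitaryPacket S₀ :=
  fun ξ S x _ hr hE => h ξ S x hr hE

/-- v6 `APacketSpectral` (asserted at every `S`) ⇒ v8 `APacketSpectral S₀` (asserted at `S ⊇ S₀`) for every `S₀`, a fortiori (R-28: the converse is what print denies). [cite: Rogawski1990, Thm. 13.3.7 p. 203] -/
theorem aPacketSpectral_of_v6 (h : F0P3InnerFormClassificationV6.ClassificationKit.APacketSpectral 𝔠) (S₀ : Finset (F0P3InnerFormClassificationV6.Places L)) : 𝔠.APacketSpectral S₀ :=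
  fun ξ S _ hr => h ξ S hr

/-- v6 `LocalExpansion` (asserted at every `S`) ⇒ v8 `LocalExpansion S₀` (asserted at `S ⊇ S₀`) for every `S₀`, a fortiori (R-28: the converse is what print denies). [cite: Rogawski1990, Thm. 14.6.4 p. 244] -/
theorem localExpansion_of_v6 (h : F0P3InnerFormClassificationV6.ClassificationKit.LocalExpansion 𝔠) (S₀ : Finset (F0P3InnerFormClassificationV6.Places L)) : 𝔠.LocalExpansion S₀ :=
  fun ξ S _ hr => h ξ S hr

/-- v6 `PerClassIdentity` (asserted at every `S`) ⇒ v8 `PerClassIdentity S₀` (asserted at `S ⊇ S₀`) for every `S₀`, a fortiori (R-28: the converse is what print denies). [cite: Rogawski1990, §14.6 (14.6.2) p. 238] -/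
theorem perClassIdentity_of_v6 (h : F0P3InnerFormClassificationV6.ClassificationKit.PerClassIdentity 𝔠) (S₀ : Finset (F0P3InnerFormClassificationV6.Places L)) : 𝔠.PerClassIdentity S₀ :=
  fun S g fS fSG fSH _ hM => h S g fS fSG fSH hM

/-- v6 `CoefficientFormula` (every admissible class in the `ξ`-fibre, every `S ⊇ ram ξ`) ⇒ v8 `CoefficientFormula S₀` (classes with `1 ≤ mult c`, `S ⊇ S₀`), a fortiori.
[cite: Rogawski1990, §14.6 p. 239] -/
theorem coefficientFormula_of_v6 (h : F0P3InnerFormClassificationV6.ClassificationKit.CoefficientFormula 𝔠) (S₀ : Finset (F0P3InnerFormClassificationV6.Places L)) : 𝔠.CoefficientFormula S₀ :=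
  fun ξ S _ hr c hc ha _ => h ξ S hr c hc ha

/-- v7 `CoefficientFormula` (`1 ≤ mult c`, every `S ⊇ ram ξ`) ⇒ v8 `CoefficientFormula S₀`, a fortiori. [cite: Rogawski1990, §14.6 p. 239] -/
theorem coefficientFormula_of_v7 (h : F0P3InnerFormClassificationV7.ClassificationKit.CoefficientFormula 𝔠) (S₀ : Finset (F0P3InnerFormClassificationV6.Places L)) : 𝔠.CoefficientFormula S₀ :=
  fun ξ S _ hr c hc ha hm => h ξ S hr c hc ha hm

/-- **`Laws.of_v6`**: a kit satisfying the v6 laws satisfies the v8 laws at EVERY level guard `S₀` (two fields dropped at v7, two `P`-laws guarded at v7, eleven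
`S`-texts levelled at v8). [cite: Rogawski1990, §14.6 Thm. 14.6.4] -/
theorem Laws.of_v6 (μω : HeckeCharacter L) (hμu : μω.IsUnitary) (h : F0P3InnerFormClassificationV6.ClassificationKit.Laws 𝔠 μω hμu) (S₀ : Finset (F0P3InnerFormClassificationV6.Places L)) :
    𝔠.Laws μω hμu S₀ :=
  ⟨h.traceIdentity, h.spectralSideGp, factorisation_of_v6 𝔠 h.factorisation S₀, matchingS_of_v6 𝔠 h.matchingS S₀, transferS_of_v6 𝔠 h.transferS S₀,
    hatBounded_of_v6 𝔠 h.hatBounded S₀, unrStarAlgebra_of_v6 𝔠 h.unrStarAlgebra S₀, h.linIndepS, h.unitaryCoord, unitaryPacket_of_v6 𝔠 h.unitaryPacket S₀,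
    aPacketSpectral_of_v6 𝔠 h.aPacketSpectral S₀, localExpansion_of_v6 𝔠 h.localExpansion S₀, routing_of_v6 𝔠 h.routing, h.tokenInf, h.archPacketCoh,
    h.archMember, h.cptXiSpec, h.xiFamilyFin, h.xiUnram, localIsotypyFin_of_v6 𝔠 h.localIsotypyFin, h.evpConvention⟩

/-- **`Laws.of_v7`**: a kit satisfying the v7 laws satisfies the v8 laws at every `S₀`. [cite: Rogawski1990, §14.6 Thm. 14.6.4] -/
theorem Laws.of_v7 (μω : HeckeCharacter L) (hμu : μω.IsUnitary) (h : F0P3InnerFormClassificationV7.ClassificationKit.Laws 𝔠 μω hμu) (S₀ : Finset (F0P3InnerFormClassificationV6.Places L)) :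
    𝔠.Laws μω hμu S₀ :=
  ⟨h.traceIdentity, h.spectralSideGp, factorisation_of_v6 𝔠 h.factorisation S₀, matchingS_of_v6 𝔠 h.matchingS S₀, transferS_of_v6 𝔠 h.transferS S₀,
    hatBounded_of_v6 𝔠 h.hatBounded S₀, unrStarAlgebra_of_v6 𝔠 h.unrStarAlgebra S₀, h.linIndepS, h.unitaryCoord, unitaryPacket_of_v6 𝔠 h.unitaryPacket S₀,
    aPacketSpectral_of_v6 𝔠 h.aPacketSpectral S₀, localExpansion_of_v6 𝔠 h.localExpansion S₀, h.routing, h.tokenInf, h.archPacketCoh,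
    h.archMember, h.cptXiSpec, h.xiFamilyFin, h.xiUnram, h.localIsotypyFin, h.evpConvention⟩

end ClassificationKit

/-! ## §4 The kit family: same type, same pins; laws transport with the witness `S₀ := ∅` -/

/-- The v8 kit-family type IS the v6 one (the kit alias unfolded). [cite: Rogawski1990, §14.6 Thm. 14.6.4] -/
theorem kitFamily_eq_v6 : KitFamily = F0P3InnerFormClassificationV6.KitFamily := rfl

/-- `KitFamily.IsPinned` is the same proposition at v6 and v8 (no pin added). [cite: Rogawski1990, §14.6 Thm. 14.6.4] -/
theorem KitFamily.isPinned_iff_v6 (𝔎 : KitFamily) : 𝔎.IsPinned ↔ F0P3InnerFormClassificationV6.KitFamily.IsPinned 𝔎 := Iff.rfl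

/-- A family satisfying the v6 laws at every letters' frame satisfies the v8 laws there (witness `S₀ := ∅`). [cite: Rogawski1990, §14.6 Thm. 14.6.4] -/
theorem KitFamily.laws_of_v6 (𝔎 : KitFamily) (h : F0P3InnerFormClassificationV6.KitFamily.Laws 𝔎) : 𝔎.Laws :=
  fun L _ _ _ ι H T hT hdef h2 μ _ μω hμu hμω => ⟨∅, ClassificationKit.Laws.of_v6 _ μω hμu (h L ι H T hT hdef h2 μ μω hμu hμω) ∅⟩

/-- Consumer check: the v8 head applies to a v6-lawful pinned family. [cite: Rogawski1990, §14.6 Thm. 14.6.4] -/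
example (𝔎 : F0P3InnerFormClassificationV6.KitFamily) (hpin : F0P3InnerFormClassificationV6.KitFamily.IsPinned 𝔎) (hlaws : F0P3InnerFormClassificationV6.KitFamily.Laws 𝔎) :=
  shapeGuarded_of_T5 𝔎 ((KitFamily.isPinned_iff_v6 𝔎).2 hpin) (KitFamily.laws_of_v6 𝔎 hlaws)

end Summit.HodgeConjecture.HodgeConjecture.Cruxes.H413.F0P3InnerFormClassificationV8
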